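import Summits.CriticalPhenomena.PercolationContinuityZ3.Theorems.Transplant.KNCells2Scheme
import Summits.CriticalPhenomena.PercolationContinuityZ3.Theorems.Transplant.KNCellsStepsDefs
import Summits.CriticalPhenomena.PercolationContinuityZ3.Theorems.Transplant.KNLevelsTargetChainEdge
import HarnessLib

/-!
# F8 (generic, LAG-1 ANCHORS) — the FACE INPUT `hface` of `fail_bound₂` / `samePWitnessAt_of_kit₂` ((I2): "the face `F^{j+1}` is reached
# ⟹ (30) holds at level `j`") from ONE TARGET STEP with an enlarged target in an auxiliary graph structure (Kozma–Nitzan's Step III, p. 30: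
# Lemma 10 applied from the face to `M_y` inside `E^far` beyond the stub `H^j`, the contacts' routes being elongated boxes of aspect `2K` —
# in the product: p3-g2's kits with elongated deep routes; design HOME/prim-bschramm-p2-g2/F8-DESIGN.md §9)

builds on p205010 (kernel theorem, internal audit signed; external expert review pending) — nothing in this file uses p205010.
Lane `prim-bschramm`, seat `prim-bschramm-p2` (Corridor-over-levels); helper file (`--supports stmt-CriticalPhenomena-4575`).

* **`cond_of_step`** — under the weighting `Wt h e a a' du j o` of (30): one target step `s` (over any `G'`) with source `root`, kits at the
  accuracy `δ₂` of the target property at `δc / 2`, first level containing the face `Face a' x du (j+1)`, enlarged target `s.T ⊇ T'` with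
  `T' ⊆ M^{a'}_{x+du}` and excess `P(root ↔ s.T \ T') ≤ η ≤ δc / 2`; then `1 - δ₂ < P_{Wt}(root ↔ Face_{j+1})` implies `cond h e a a' du j o`.
[cite: KozmaNitzan2024, §4 p. 30 (Step III), Lemma 10 (p. 17)] [cite: GrimmettPercolation1999, §7.2]
-/

noncomputable section

open MeasureTheory ProbabilityTheory
open scoped ENNReal Classical

namespace Summit.CriticalPhenomena.PercolationContinuityZ3.Theorems

namespace Transplant

namespace KNCells

open Literature.Probability.Percolation Literature.Probability.LatticeModels SimpleGraph GadgetSystem ProbeHistory HSiteScheme Contour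

variable {V : Type*} [DecidableEq V]

namespace KSchA

variable {A : Type*} {G : SimpleGraph V} [G.LocallyFinite] {S : KSchA V A} {FD : FaceData V A}
variable {h : ProbeHistory V} {e : Site 2 × MDir} {a a' : A} {du : MDir} {j : ℕ} {o : Finset (Sym2 V)}

/-- **(I2) FROM ONE TARGET STEP WITH AN ENLARGED TARGET.** [cite: KozmaNitzan2024, §4 p. 30 (Step III), Lemma 10 (p. 17)] -/
theorem cond_of_step (G' : SimpleGraph V) [G'.LocallyFinite] {Δ' : ℕ} {δ₂ η : ℝ}
    (hstep : ∀ (W : Sym2 V → unitInterval) (s : KNLevels.TStep G'), s.KitsAt W S.p Δ' δ₂ →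
      1 - δ₂ < (prodBernoulli W).real s.L.reachB → 1 - S.δc / 2 < (prodBernoulli W).real (⋃ t ∈ s.T, openConn s.L.o t))
    (s : KNLevels.TStep G') (ho : s.L.o = S.Γ.root) (hkits : s.KitsAt (S.Wt G h e a a' du j o) S.p Δ' δ₂)
    (T' : Finset V) (hT' : T' ⊆ s.T) (hT'M : T' ⊆ S.Γ.M a' (tgt e + stepVec du))
    (hexc : (prodBernoulli (S.Wt G h e a a' du j o)).real (⋃ t ∈ s.T \ T', openConn S.Γ.root t) ≤ η) (hη : η ≤ S.δc / 2)
    (hface : FD.Face a' (tgt e) du (j + 1) ⊆ s.L.X 0)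
    (hsrc : 1 - δ₂ < (prodBernoulli (S.Wt G h e a a' du j o)).real (⋃ b ∈ FD.Face a' (tgt e) du (j + 1), openConn S.Γ.root b)) :
    S.cond G h e a a' du j o := by
  set W := S.Wt G h e a a' du j o with hW
  -- the source: the face lies in the first level
  have hreachB : 1 - δ₂ < (prodBernoulli W).real s.L.reachB := by
    refine hsrc.trans_le (measureReal_mono ?_ (measure_ne_top _ _))
    intro ω hω
    simp only [Set.mem_iUnion, exists_prop] at hω
    obtain ⟨b, hb, hωb⟩ := hω
    rw [KNLevels.LData.reachB, ho]
    exact Set.mem_biUnion (Finset.mem_coe.2 (hface hb)) hωb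
  have h1 := hstep W s hkits hreachB
  rw [ho] at h1
  have h2 := KNLevels.real_biUnion_openConn_le_add_sdiff (prodBernoulli W) S.Γ.root hT'
  have h3 : (prodBernoulli W).real (⋃ t ∈ T', openConn S.Γ.root t) ≤ (prodBernoulli W).real (S.Conn a' e du) := by
    refine measureReal_mono ?_ (measure_ne_top _ _)
    intro ω hω
    simp only [Set.mem_iUnion, exists_prop] at hω
    obtain ⟨t, ht, hωt⟩ := hω
    rw [Conn]
    exact Set.mem_biUnion (Finset.mem_coe.2 (hT'M ht)) hωt
  rw [cond]
  linarith

end KSchA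

end KNCells

end Transplant

end Summit.CriticalPhenomena.PercolationContinuityZ3.Theorems

end
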